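import Summits.QuantumAdvantage.QuantumAdvantage.Theorems.SymplecticPurityDlogGraphFlatHolder

/-!
# Crux `DlogGraphFlat` (stmt-QuantumAdvantage-10732), line `Sketch` — sector B: the WEAKEST fourth-moment
# hypothesis the Hölder reduction can use (`stub_dlogWalshHolderWeak`)

The landed Hölder step (`walsh_pow_four_le_moment`, `stub_dlogWalshHolder`) reduces the twisted Walsh
sums `W(α,β) = Σ_x (−1)^{α·x}(−1)^{β·bits(gˣ mod p)}` to the fourth dilation moment
`M4 = Σ_λ (Σ_{u} ε_u F_β(λ g^{ofBits u}))⁴` over the low digit block, asking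
`M4 ≤ C (4^m p + 16^m p^{1−η})` for EVERY sign pattern `ε` and EVERY `m ≤ μ n`
(`stub_dlogFourthDilationMoment`, FDM). This file records that much less is needed:

* the block may be ANY digit mask `D` (`walsh_pow_four_le_moment_mask`), chosen by whoever proves the
  moment bound (depending on `p, g, β, α`), of any weight `|D| ≥ μ n`;
* the signs only need to be the genuine Walsh character `ε_u = (−1)^{α·u}`;
* the bound only needs to be a POWER SAVING over `2^{3|D|}·p`: `M4 ≤ C · 2^{(3−κ)|D|} · p` for some
  fixed `κ > 0` (the trivial bound is `2^{4|D|} p`; FDM's shape is the special case `κ = 1` up to the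
  `p^{−η}` tail). Indeed `|W|⁴ ≤ 2^{3(n−|D|)} · 2 · M4 ≤ 2C · 2^{4n − κ|D|}`.

`stub_dlogWalshHolderWeak : FDMweak → (sector B, α ≠ 0)` with `δ = κ μ / 8`. No new definitions.
-/

set_option linter.dupNamespace false -- D-0017: single-problem summit ⇒ `QuantumAdvantage.QuantumAdvantage` by design

namespace Summit.QuantumAdvantage.QuantumAdvantage.Theorems.SymplecticPurity

open Finset Literature.Computability.QuantumComplexity Literature.Computability.Cryptography

section HolderWeak

variable {n : ℕ}

/-- **Hölder over an arbitrary digit mask of the exponent.** For every mask `d`, every pair of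
Walsh masks `α, β`: with `PV = {x ∧ ¬d}` (high patterns) and `PJ = {u : u ≼ d}` (block patterns),
`|W(α,β)|⁴ ≤ |PV|³ · 2 · Σ_{λ ∈ ZMod p} (Σ_{u ∈ PJ} (−1)^{α·u} F_β(λ g^{ofBits u}))⁴`. -/
theorem walsh_pow_four_le_moment_mask {p g : ℕ} [hpf : Fact p.Prime]
    (hg : orderOf (g : ZMod p) = p - 1) (h2 : 2 ^ n ≤ 2 * (p - 1)) (α β d : QReg n) :
    |∑ x : QReg n, (∏ i : Fin n, (if α i && x i then (-1 : ℝ) else 1)) *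
        (∏ i : Fin n, (if β i && (g ^ Nat.ofBits x % p).testBit (i : ℕ) then (-1 : ℝ) else 1))| ^ 4 ≤
      ((Finset.univ.image fun x : QReg n => fun j => x j && !d j).card : ℝ) ^ 3 *
        (2 * ∑ lam : ZMod p,
          (∑ u ∈ (Finset.univ.filter fun u : QReg n => ∀ j : Fin n, d j = false → u j = false),
            (∏ i : Fin n, (if α i && u i then (-1 : ℝ) else 1)) *
              ∏ i : Fin n, (if β i && (lam * (g : ZMod p) ^ Nat.ofBits u).val.testBit (i : ℕ)
                then (-1 : ℝ) else 1)) ^ 4) := by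
  classical
  set G : ZMod p := (g : ZMod p) with hG
  set A : QReg n → ℝ := fun z => ∏ i : Fin n, (if α i && z i then (-1 : ℝ) else 1) with hA
  set F : ZMod p → ℝ := fun y => ∏ i : Fin n, (if β i && y.val.testBit (i : ℕ) then (-1 : ℝ) else 1)
    with hF
  set PV := Finset.univ.image fun x : QReg n => fun j => x j && !d j with hPV
  set PJ := Finset.univ.filter fun u : QReg n => ∀ j : Fin n, d j = false → u j = false with hPJ
  set I : ZMod p → ℝ := fun lam => ∑ u ∈ PJ, A u * F (lam * G ^ Nat.ofBits u) with hI
  have hval : ∀ x : QReg n, (g ^ Nat.ofBits x % p) = (G ^ Nat.ofBits x).val := by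
    intro x
    rw [hG, ← Nat.cast_pow, ZMod.val_natCast]
  have hsummand : ∀ x : QReg n,
      (∏ i : Fin n, (if α i && x i then (-1 : ℝ) else 1)) *
        (∏ i : Fin n, (if β i && (g ^ Nat.ofBits x % p).testBit (i : ℕ) then (-1 : ℝ) else 1)) =
      A (fun j => x j && !d j) *
        (A (fun j => x j && d j) *
          F (G ^ Nat.ofBits (fun j => x j && !d j) * G ^ Nat.ofBits (fun j => x j && d j))) := by
    intro x
    rw [hval x, ← pow_add, add_comm, ← ofBits_split x d, hA, hF]
    simp only
    rw [sign_split α x d]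
    ring
  have hW : ∑ x : QReg n, (∏ i : Fin n, (if α i && x i then (-1 : ℝ) else 1)) *
        (∏ i : Fin n, (if β i && (g ^ Nat.ofBits x % p).testBit (i : ℕ) then (-1 : ℝ) else 1)) =
      ∑ v ∈ PV, A v * I (G ^ Nat.ofBits v) := by
    rw [Finset.sum_congr rfl (fun x _ => hsummand x)]
    rw [← Finset.sum_fiberwise_of_maps_to (s := Finset.univ) (t := PV)
      (g := fun x : QReg n => fun j => x j && !d j) (fun x _ => Finset.mem_image_of_mem _ (Finset.mem_univ x))]
    refine Finset.sum_congr rfl fun v hv => ?_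
    have hv' : ∀ j, d j = true → v j = false := by
      rw [hPV, Finset.mem_image] at hv
      obtain ⟨x, _, rfl⟩ := hv
      intro j hj; simp [hj]
    have step : ∀ x ∈ (Finset.univ.filter fun x : QReg n => (fun j => x j && !d j) = v),
        A (fun j => x j && !d j) *
          (A (fun j => x j && d j) *
            F (G ^ Nat.ofBits (fun j => x j && !d j) * G ^ Nat.ofBits (fun j => x j && d j))) =
        A v * ((fun u => A u * F (G ^ Nat.ofBits v * G ^ Nat.ofBits u)) (fun j => x j && d j)) := by
      intro x hx
      rw [Finset.mem_filter] at hx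
      rw [hx.2]
    rw [Finset.sum_congr rfl step, ← Finset.mul_sum,
      sum_fibre_block d v hv' (fun u => A u * F (G ^ Nat.ofBits v * G ^ Nat.ofBits u)), ← hPJ]
  rw [hW]
  have htri : |∑ v ∈ PV, A v * I (G ^ Nat.ofBits v)| ≤ ∑ v ∈ PV, |I (G ^ Nat.ofBits v)| := by
    refine (Finset.abs_sum_le_sum_abs _ _).trans (le_of_eq (Finset.sum_congr rfl fun v _ => ?_))
    rw [abs_mul, hA]
    simp only
    rw [abs_sign_prod, one_mul]
  have h4 := sum_abs_pow_four_le PV (fun v => I (G ^ Nat.ofBits v))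
  have hmult := sum_pow_orbit_le hg h2 PV (fun t => (I t) ^ 4)
    (fun t => by positivity)
  have habs0 : 0 ≤ |∑ v ∈ PV, A v * I (G ^ Nat.ofBits v)| := abs_nonneg _
  calc |∑ v ∈ PV, A v * I (G ^ Nat.ofBits v)| ^ 4
      ≤ (∑ v ∈ PV, |I (G ^ Nat.ofBits v)|) ^ 4 := pow_le_pow_left₀ habs0 htri 4
    _ ≤ (PV.card : ℝ) ^ 3 * ∑ v ∈ PV, (I (G ^ Nat.ofBits v)) ^ 4 := h4
    _ ≤ (PV.card : ℝ) ^ 3 * (2 * ∑ t : ZMod p, (I t) ^ 4) :=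
        mul_le_mul_of_nonneg_left hmult (by positivity)

/-- Real bookkeeping of the weak Hölder reduction: from `|W|⁴ ≤ T³ · 2M`, `T ≤ 2^{n−m}`,
`M ≤ C · 2^{(3−κ) m} · p`, `p ≤ 2ⁿ`, `μ n ≤ m`: `W ≤ (2C)^{1/4} · 2^{(1 − κ μ / 4) n}`. -/
theorem holder_numerics_weak (κ μ C : ℝ) (hκ : 0 < κ) (hC : 0 < C) (n m p : ℕ) (W T M : ℝ)
    (hm1 : μ * n ≤ m) (hp2 : (p : ℝ) ≤ (2 : ℝ) ^ (n : ℝ)) (hW0 : 0 ≤ W)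
    (hT0 : 0 ≤ T) (hM0 : 0 ≤ M) (hW : W ^ 4 ≤ T ^ 3 * (2 * M)) (hT : T ≤ (2 : ℝ) ^ ((n : ℝ) - m))
    (hM : M ≤ C * (2 : ℝ) ^ ((3 - κ) * (m : ℝ)) * p) :
    W ≤ (2 * C) ^ (4 : ℝ)⁻¹ * (2 : ℝ) ^ ((1 - κ * μ / 4) * (n : ℝ)) := by
  have h2pos : (0 : ℝ) < 2 := by norm_num
  have hp0 : (0 : ℝ) ≤ p := Nat.cast_nonneg _
  -- W^4 ≤ 2^{3(n-m)} · 2 · C · 2^{(3-κ)m} · 2^n = 2C · 2^{4n - κ m}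
  have hT3 : T ^ 3 ≤ ((2 : ℝ) ^ ((n : ℝ) - m)) ^ 3 := pow_le_pow_left₀ hT0 hT 3
  have hM' : M ≤ C * (2 : ℝ) ^ ((3 - κ) * (m : ℝ)) * (2 : ℝ) ^ (n : ℝ) :=
    hM.trans (mul_le_mul_of_nonneg_left hp2 (by positivity))
  have hW4 : W ^ 4 ≤ ((2 : ℝ) ^ ((n : ℝ) - m)) ^ 3 * (2 * (C * (2 : ℝ) ^ ((3 - κ) * (m : ℝ)) *
      (2 : ℝ) ^ (n : ℝ))) := by
    calc W ^ 4 ≤ T ^ 3 * (2 * M) := hW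
      _ ≤ ((2 : ℝ) ^ ((n : ℝ) - m)) ^ 3 * (2 * M) := mul_le_mul_of_nonneg_right hT3 (by positivity)
      _ ≤ ((2 : ℝ) ^ ((n : ℝ) - m)) ^ 3 * (2 * (C * (2 : ℝ) ^ ((3 - κ) * (m : ℝ)) *
          (2 : ℝ) ^ (n : ℝ))) := by
          refine mul_le_mul_of_nonneg_left ?_ (by positivity)
          exact mul_le_mul_of_nonneg_left hM' (by norm_num)
  have hexp : ((2 : ℝ) ^ ((n : ℝ) - m)) ^ 3 * (2 * (C * (2 : ℝ) ^ ((3 - κ) * (m : ℝ)) *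
      (2 : ℝ) ^ (n : ℝ))) = 2 * C * (2 : ℝ) ^ (4 * (n : ℝ) - κ * m) := by
    rw [← Real.rpow_natCast ((2 : ℝ) ^ ((n : ℝ) - m)) 3, ← Real.rpow_mul h2pos.le]
    have e : (2 : ℝ) ^ (4 * (n : ℝ) - κ * m) =
        (2 : ℝ) ^ (((n : ℝ) - m) * (3 : ℕ)) * ((2 : ℝ) ^ ((3 - κ) * (m : ℝ)) * (2 : ℝ) ^ (n : ℝ)) := by
      rw [← Real.rpow_add h2pos, ← Real.rpow_add h2pos]
      congr 1; push_cast; ring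
    rw [e]; ring
  rw [hexp] at hW4
  -- 4n - κ m ≤ (4 - κ μ) n
  have hexp2 : (2 : ℝ) ^ (4 * (n : ℝ) - κ * m) ≤ (2 : ℝ) ^ ((4 - κ * μ) * (n : ℝ)) := by
    refine Real.rpow_le_rpow_of_exponent_le (by norm_num) ?_
    have : κ * (μ * n) ≤ κ * m := mul_le_mul_of_nonneg_left hm1 hκ.le
    nlinarith
  have hW4' : W ^ 4 ≤ 2 * C * (2 : ℝ) ^ ((4 - κ * μ) * (n : ℝ)) :=
    hW4.trans (mul_le_mul_of_nonneg_left hexp2 (by positivity))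
  -- take fourth roots
  have hroot : W = (W ^ 4) ^ (4 : ℝ)⁻¹ := by
    rw [← Real.rpow_natCast W 4, ← Real.rpow_mul hW0]; norm_num
  rw [hroot]
  have hrhs : (2 * C * (2 : ℝ) ^ ((4 - κ * μ) * (n : ℝ))) ^ (4 : ℝ)⁻¹ =
      (2 * C) ^ (4 : ℝ)⁻¹ * (2 : ℝ) ^ ((1 - κ * μ / 4) * (n : ℝ)) := by
    rw [Real.mul_rpow (by positivity) (by positivity), ← Real.rpow_mul h2pos.le]
    congr 2; ring
  rw [← hrhs]
  exact Real.rpow_le_rpow (by positivity) hW4' (by norm_num)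

/-- **`stub_dlogWalshHolderWeak`** — the weakest fourth-moment statement the Hölder/Burgess reduction of
sector B can use. HYPOTHESIS (FDMweak): there are `κ, μ, C > 0` and `n₀` such that for every `n ≥ n₀`,
every admissible `(p, g)` (window, primitivity, NAF guard), every `β ≠ 0` and every `α`, SOME digit
mask `D` of weight `|D| ≥ μ n` has
`Σ_{λ ∈ 𝔽_p} (Σ_{u ≼ D} (−1)^{α·u} F_β(λ g^{ofBits u}))⁴ ≤ C · 2^{(3−κ)|D|} · p`
(a power saving `2^{−κ|D|}` over `2^{3|D|} p`; the diagonal is `≈ 3·4^{|D|} p`). CONCLUSION: sector B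
with `α ≠ 0`, `|W(α,β)| ≤ 2^{(1−δ)n}`, `δ = κμ/8`. Compared with `stub_dlogWalshHolder` the mask is
free, the signs are the Walsh character only, a single weight per `n` suffices, and any `κ > 0` does. -/
theorem stub_dlogWalshHolderWeak :
    (∃ κ : ℝ, 0 < κ ∧ ∃ μ : ℝ, 0 < μ ∧ ∃ C : ℝ, 0 < C ∧ ∃ n₀ : ℕ, ∀ n ≥ n₀,
      ∀ (p : ℕ) [Fact (Nat.Prime p)] (g : ℕ), p < 2 ^ n → 2 ^ n ≤ p + 2 ^ (53 * n / 100) →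
      orderOf (g : ZMod p) = p - 1 →
      (∀ c : Fin (n + 1) → ℤ, (∀ i, c i = 0 ∨ c i = 1 ∨ c i = -1) →
        ∑ i, c i * 2 ^ (i : ℕ) = (p : ℤ) - 1 → n ≤ 8 * (Finset.univ.filter fun i => c i ≠ 0).card) →
      ∀ β : QReg n, β ≠ (fun _ => false) → ∀ α : QReg n,
      ∃ D : QReg n, μ * (n : ℝ) ≤ ((Finset.univ.filter fun j => D j = true).card : ℝ) ∧
      ∑ lam : ZMod p,
        (∑ u ∈ (Finset.univ.filter fun u : QReg n => ∀ j : Fin n, D j = false → u j = false),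
          (∏ i : Fin n, (if α i && u i then (-1 : ℝ) else 1)) *
            ∏ i : Fin n, (if β i && (lam * (g : ZMod p) ^ Nat.ofBits u).val.testBit (i : ℕ)
              then (-1 : ℝ) else 1)) ^ 4 ≤
        C * (2 : ℝ) ^ ((3 - κ) * ((Finset.univ.filter fun j => D j = true).card : ℝ)) * p) →
    (∃ δ : ℝ, 0 < δ ∧ ∃ n₀ : ℕ, ∀ n ≥ n₀, ∀ p g : ℕ, p.Prime → p < 2 ^ n →
      2 ^ n ≤ p + 2 ^ (53 * n / 100) → orderOf (g : ZMod p) = p - 1 →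
      (∀ c : Fin (n + 1) → ℤ, (∀ i, c i = 0 ∨ c i = 1 ∨ c i = -1) →
        ∑ i, c i * 2 ^ (i : ℕ) = (p : ℤ) - 1 → n ≤ 8 * (Finset.univ.filter fun i => c i ≠ 0).card) →
      ∀ β : QReg n, β ≠ (fun _ => false) → ∀ α : QReg n, α ≠ (fun _ => false) →
      |∑ x : QReg n, (∏ i : Fin n, (if α i && x i then (-1 : ℝ) else 1)) *
          (∏ i : Fin n, (if β i && (g ^ Nat.ofBits x % p).testBit (i : ℕ) then (-1 : ℝ) else 1))|
        ≤ (2 : ℝ) ^ ((1 - δ) * (n : ℝ))) := by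
  rintro ⟨κ, hκ, μ, hμ, C, hC, n₀, hF⟩
  set δ : ℝ := κ * μ / 8 with hδ
  have hδpos : 0 < δ := by positivity
  set K : ℝ := (2 * C) ^ (4 : ℝ)⁻¹ with hK
  have hKpos : 0 < K := by positivity
  obtain ⟨n₁, hn₁⟩ := exists_nat_ge (Real.logb 2 K / (κ * μ / 8))
  refine ⟨δ, hδpos, max (max n₀ 4) n₁, ?_⟩
  intro n hn p g hp hpn hwin hg hguard β hβ α _hα
  classical
  haveI hpf : Fact p.Prime := ⟨hp⟩
  have hn₀ : n₀ ≤ n := le_trans ((le_max_left _ _).trans (le_max_left _ _)) hn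
  have hn4 : 4 ≤ n := le_trans ((le_max_right _ _).trans (le_max_left _ _)) hn
  have hnn₁ : n₁ ≤ n := le_trans (le_max_right _ _) hn
  have h53 : 53 * n / 100 ≤ n - 2 := by omega
  have hq : 2 ^ (53 * n / 100) ≤ 2 ^ (n - 2) := Nat.pow_le_pow_right (by norm_num) h53
  have h2n : 2 ^ n = 4 * 2 ^ (n - 2) := by
    conv_lhs => rw [show n = (n - 2) + 2 from by omega, Nat.pow_add]
    ring
  have hq4 : 4 ≤ 2 ^ (n - 2) := by
    calc 4 = 2 ^ 2 := by norm_num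
      _ ≤ 2 ^ (n - 2) := Nat.pow_le_pow_right (by norm_num) (by omega)
  have hp3 : 3 * 2 ^ (n - 2) ≤ p := by omega
  have h2p1 : 2 ^ n ≤ 2 * (p - 1) := by omega
  obtain ⟨D, hDμ, hM⟩ := hF n hn₀ p g hpn hwin hg hguard β hβ α
  set m : ℕ := (Finset.univ.filter fun j => D j = true).card with hm
  have hmn : m ≤ n := by
    have := Finset.card_filter_le (Finset.univ : Finset (Fin n)) (fun j => D j = true)
    simpa using this
  have hH := walsh_pow_four_le_moment_mask (p := p) (g := g) hg h2p1 α β D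
  have hT : ((Finset.univ.image fun x : QReg n => fun j => x j && !D j).card : ℝ)
      ≤ (2 : ℝ) ^ ((n : ℝ) - m) := by
    have h1 := card_image_bits_out_le (n := n) D
    rw [← hm] at h1
    have h4 : ((2 ^ (n - m) : ℕ) : ℝ) = (2 : ℝ) ^ ((n : ℝ) - m) := by
      rw [← Nat.cast_sub hmn, Real.rpow_natCast]; push_cast; ring
    rw [← h4]; exact_mod_cast h1
  have hp2 : (p : ℝ) ≤ (2 : ℝ) ^ (n : ℝ) := by
    rw [Real.rpow_natCast]; exact_mod_cast hpn.le
  have hres := holder_numerics_weak κ μ C hκ hC n m p _ _ _ hDμ hp2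
    (abs_nonneg _) (Nat.cast_nonneg _) (Finset.sum_nonneg fun _ _ => by positivity) hH hT hM
  refine hres.trans ?_
  have h2pos : (0 : ℝ) < 2 := by norm_num
  have hμ8 : (0 : ℝ) < κ * μ / 8 := by positivity
  have hn₁' : Real.logb 2 K / (κ * μ / 8) ≤ (n : ℝ) := hn₁.trans (by exact_mod_cast hnn₁)
  have hlog : Real.logb 2 K ≤ (κ * μ / 8) * (n : ℝ) := by
    rw [div_le_iff₀ hμ8] at hn₁'; linarith
  have hK2 : K ≤ (2 : ℝ) ^ ((κ * μ / 8) * (n : ℝ)) :=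
    (Real.logb_le_iff_le_rpow (by norm_num) hKpos).mp hlog
  have hsplit : (2 : ℝ) ^ ((1 - δ) * (n : ℝ)) =
      (2 : ℝ) ^ ((κ * μ / 8) * (n : ℝ)) * (2 : ℝ) ^ ((1 - κ * μ / 4) * (n : ℝ)) := by
    rw [← Real.rpow_add h2pos, hδ]; ring_nf
  rw [hsplit]
  exact mul_le_mul_of_nonneg_right hK2 (by positivity)

end HolderWeak

end Summit.QuantumAdvantage.QuantumAdvantage.Theorems.SymplecticPurity
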